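import Summits.CriticalPhenomena.PercolationContinuityZ3.Theorems.PercShatteringRaceNearLinearTwoClusterDecayConsumedBoxLRO

/-!
# Triage r2/k1 scratch — card `worlds-split-density-sampling` (crux stmt-CriticalPhenomena-5785)

Two certified facts used in TRIAGE-r2-1.md:

1. `percolationContinuityZ3_of_powerSaving_of_jumpPairDecay` — the card's stub S1 (`JumpPairDecay`,
   PAIR form of the crux in the jump world, exactly as typed in `SketchIdeator4R2.lean`) ALONE,
   together with the other crux `S(1/2)`, already closes the route (via the landed
   `raceLemma_of_jumpBoxLRO`, p125450).  Hence S2 (`JumpNoThinStrands`), S3 (`CruxNullWorld`) and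
   the density-sampling lever are never consumed by route PercShatteringRace.
2. `pairBad_of_conn`, `card_trace_mul_le_card_badPairs`, `twoCluster_subset_thin_union_dense` — the
   deterministic core of the card's lever (`PairCountBound` / `DensitySampling`): the three
   "inheritance facts" and the thin/dense dichotomy are correct as typed.
-/

noncomputable section

namespace TriageR2K1

open MeasureTheory Filter Topology
open Literature.Probability.LatticeModels Literature.Probability.Percolation
open Summit.CriticalPhenomena.PercolationContinuityZ3.Theorems
open Summit.CriticalPhenomena.PercolationContinuityZ3.Theorems.NearLinearTwoClusterDecay.Consumed

/-- The critical bond measure `P_{p_c}` on `ℤ³` (card vocabulary). -/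
abbrev Pc : Measure (BondConfig (Site 3)) := bondPercolation (zdGraph 3) (criticalProbI 3)

/-- `θ(p_c)` (card vocabulary). -/
abbrev thetaC : ℝ := theta (zdGraph 3) 0 (criticalProbI 3)

/-- The crux's outer radius `m = ⌈n^{7/6}⌉` (card vocabulary). -/
def outer (n : ℕ) : ℕ := ⌈(n : ℝ) ^ ((7 : ℝ) / 6)⌉₊

/-- `x` reaches `∂ⁱⁿΛ(m)` inside `Λ(m)` (card vocabulary). -/
def reachesOut (m : ℕ) (x : Site 3) : Set (BondConfig (Site 3)) :=
  {ω | ∃ y ∈ innerBoundary (zdGraph 3) (box 3 m), ω ∈ openConnIn ↑(box 3 m) x y}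

/-- Pair form of the crux event for a deterministic pair (card vocabulary). -/
def pairBad (m : ℕ) (x x' : Site 3) : Set (BondConfig (Site 3)) :=
  reachesOut m x ∩ reachesOut m x' ∩ (openConnIn ↑(box 3 m) x x')ᶜ

/-- Union form (the crux event at inner radius `n`, outer radius `m`; card vocabulary). -/
def twoCluster (n m : ℕ) : Set (BondConfig (Site 3)) :=
  {ω | ∃ x ∈ box 3 n, ∃ x' ∈ box 3 n, ω ∈ pairBad m x x'}

/-- S1 of the card, verbatim. -/
def JumpPairDecay : Prop :=
  0 < thetaC → ∀ ε : ℝ, 0 < ε → ∀ᶠ n : ℕ in atTop,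
    ∀ x ∈ box 3 n, ∀ x' ∈ box 3 n, Pc.real (pairBad (outer n) x x') ≤ ε

/-! ## 1. S1 alone closes the route -/

theorem openConnIn_symm'' {S : Set (Site 3)} {x y : Site 3} {ω : BondConfig (Site 3)}
    (h : ω ∈ openConnIn S x y) : ω ∈ openConnIn S y x := by
  obtain ⟨hx, hy, h⟩ := h
  exact ⟨hy, hx, h.symm⟩

theorem openConnIn_trans'' {S : Set (Site 3)} {x y z : Site 3} {ω : BondConfig (Site 3)}
    (h1 : ω ∈ openConnIn S x y) (h2 : ω ∈ openConnIn S y z) : ω ∈ openConnIn S x z := by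
  obtain ⟨hx, hy, h⟩ := h1
  obtain ⟨hy', hz, h'⟩ := h2
  exact ⟨hx, hz, h.trans h'⟩

/-- PAIR version of the landed `theta_sq_le_real_openConnIn_add_real_twoClusters`:
`θ(p)² ≤ P_p(x ↔ x' in Λ_R) + P_p(pairBad R x x')` (Harris–FKG + first exits; no uniqueness). -/
theorem theta_sq_le_real_openConnIn_add_real_pairBad (p : unitInterval) {R : ℕ} {x x' : Site 3}
    (hx : x ∈ box 3 R) (hx' : x' ∈ box 3 R) :
    theta (zdGraph 3) 0 p ^ 2 ≤
      (bondPercolation (zdGraph 3) p).real (openConnIn (↑(box 3 R) : Set (Site 3)) x x') +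
        (bondPercolation (zdGraph 3) p).real (pairBad R x x') := by
  calc theta (zdGraph 3) 0 p ^ 2 = theta (zdGraph 3) x p * theta (zdGraph 3) x' p := by
        rw [sq, theta_zdGraph_eq_theta_zero p x, theta_zdGraph_eq_theta_zero p x']
    _ ≤ (bondPercolation (zdGraph 3) p).real (percolatesAt x ∩ percolatesAt x') :=
        harris_fkg_holds (zdGraph 3) p (isUpperSet_percolatesAt x) (isUpperSet_percolatesAt x')
          (measurableSet_percolatesAt_holds x) (measurableSet_percolatesAt_holds x')
    _ ≤ (bondPercolation (zdGraph 3) p).real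
          (openConnIn (↑(box 3 R) : Set (Site 3)) x x' ∪ pairBad R x x') := by
        refine DCT16.real_mono_of_forall_subset_edgeSet (zdGraph 3) p fun ω hω hmem => ?_
        by_cases hc : ω ∈ openConnIn (↑(box 3 R) : Set (Site 3)) x x'
        · exact Or.inl hc
        · obtain ⟨y, hy, hxy⟩ := exists_openConnIn_innerBoundary_of_percolatesAt hx hω hmem.1
          obtain ⟨y', hy', hxy'⟩ := exists_openConnIn_innerBoundary_of_percolatesAt hx' hω hmem.2
          exact Or.inr ⟨⟨⟨y, hy, hxy⟩, ⟨y', hy', hxy'⟩⟩, hc⟩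
    _ ≤ _ := measureReal_union_le _ _

/-- S1 ⇒ the route's CONSUMED form (jump in-box LRO at aspect `7/6`, `c = θ²/2`). -/
theorem jumpBoxLRO_of_jumpPairDecay (h : JumpPairDecay) :
    0 < theta (zdGraph 3) 0 (criticalProbI 3) → ∃ c : ℝ, 0 < c ∧ ∀ᶠ n : ℕ in atTop, ∀ y ∈ box 3 n,
      c ≤ (bondPercolation (zdGraph 3) (criticalProbI 3)).real
        (openConnIn (↑(box 3 ⌈(n : ℝ) ^ (1 + 1 / 6 : ℝ)⌉₊) : Set (Site 3)) 0 y) := by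
  intro hθ
  refine ⟨thetaC ^ 2 / 2, by positivity, ?_⟩
  have hε : 0 < thetaC ^ 2 / 2 := by positivity
  filter_upwards [h hθ _ hε] with n hn y hy
  have e : (1 + 1 / 6 : ℝ) = (7 : ℝ) / 6 := by norm_num
  rw [e]
  have hle : n ≤ outer n := le_nat_ceil_rpow (by norm_num : (1 : ℝ) ≤ 7 / 6) n
  have h1 := theta_sq_le_real_openConnIn_add_real_pairBad (criticalProbI 3)
    (box_mono 3 hle (zero_mem_box 3 n)) (box_mono 3 hle hy)
  have h2 := hn 0 (zero_mem_box 3 n) y hy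
  show thetaC ^ 2 / 2 ≤ Pc.real (openConnIn (↑(box 3 (outer n)) : Set (Site 3)) 0 y)
  unfold thetaC at *
  linarith

/-- **S1 alone (with `S(1/2)`) closes the route**: `FreeSusceptibilityPowerSaving → JumpPairDecay →
θ(p_c) = 0`.  So the union-form extras S2/S3 and the density-sampling lever are dead weight for
route PercShatteringRace. -/
theorem percolationContinuityZ3_of_powerSaving_of_jumpPairDecay
    (hS : Summit.CriticalPhenomena.PercolationContinuityZ3.Theses.PercShatteringRace.FreeSusceptibilityPowerSaving)
    (h1 : JumpPairDecay) : _root_.PercolationContinuityZ3 := by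
  have h := raceLemma_of_jumpBoxLRO (1 / 2) (1 / 6) (by norm_num) (by norm_num)
  have e1 : (3 : ℝ) - 1 / 2 = 5 / 2 := by norm_num
  rw [e1] at h
  exact h hS (jumpBoxLRO_of_jumpPairDecay h1)

/-! ## 2. The lever's deterministic core (inheritance facts + dichotomy) -/

/-- Inheritance: points joined (inside `Λ(m)`) to the two witnesses of a bad pair form a bad pair. -/
theorem pairBad_of_conn {m : ℕ} {x x' y y' : Site 3} {ω : BondConfig (Site 3)}
    (h : ω ∈ pairBad m x x') (hy : ω ∈ openConnIn ↑(box 3 m) x y)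
    (hy' : ω ∈ openConnIn ↑(box 3 m) x' y') : ω ∈ pairBad m y y' := by
  obtain ⟨⟨⟨z, hz, hxz⟩, ⟨z', hz', hxz'⟩⟩, hc⟩ := h
  refine ⟨⟨⟨z, hz, openConnIn_trans'' (openConnIn_symm'' hy) hxz⟩,
    ⟨z', hz', openConnIn_trans'' (openConnIn_symm'' hy') hxz'⟩⟩, fun hyy' => hc ?_⟩
  exact openConnIn_trans'' (openConnIn_trans'' hy hyy') (openConnIn_symm'' hy')

open Classical in
/-- The `Λ(n)`-trace of the `Λ(m)`-cluster of `x` (Finset form of the card's `innerTrace`). -/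
def trace (n m : ℕ) (ω : BondConfig (Site 3)) (x : Site 3) : Finset (Site 3) :=
  (box 3 n).filter fun y => ω ∈ openConnIn ↑(box 3 m) x y

open Classical in
/-- The ordered bad pairs of `Λ(n)²`. -/
def badPairs (n m : ℕ) (ω : BondConfig (Site 3)) : Finset (Site 3 × Site 3) :=
  (box 3 n ×ˢ box 3 n).filter fun q => ω ∈ pairBad m q.1 q.2

/-- The card's `innerTrace` is the cardinality of `trace`. -/
theorem ncard_eq_card_trace (n m : ℕ) (ω : BondConfig (Site 3)) (x : Site 3) :
    Set.ncard {y : Site 3 | y ∈ box 3 n ∧ ω ∈ openConnIn ↑(box 3 m) x y} = (trace n m ω x).card := by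
  classical
  rw [← Set.ncard_coe_finset]
  congr 1
  ext y
  simp [trace]

/-- Counting: on a bad pair `(x, x')`, `|trace x| · |trace x'| ≤ #badPairs`. -/
theorem card_trace_mul_le_card_badPairs {n m : ℕ} {x x' : Site 3} {ω : BondConfig (Site 3)}
    (h : ω ∈ pairBad m x x') :
    (trace n m ω x).card * (trace n m ω x').card ≤ (badPairs n m ω).card := by
  classical
  rw [← Finset.card_product]
  refine Finset.card_le_card fun q hq => ?_
  simp only [Finset.mem_product, trace, Finset.mem_filter] at hq
  simp only [badPairs, Finset.mem_filter, Finset.mem_product]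
  exact ⟨⟨hq.1.1, hq.2.1⟩, pairBad_of_conn h hq.1.2 hq.2.2⟩

/-- Thin-strand event (S2's event at general `κ`, outer radius `m`). -/
def thinEvt (n m : ℕ) (κ : ℝ) : Set (BondConfig (Site 3)) :=
  {ω | ∃ x ∈ box 3 n, ω ∈ reachesOut m x ∧ ((trace n m ω x).card : ℝ) < κ * (box 3 n).card}

/-- Dense-bad-pair event (the event bounded by `PairCountBound`). -/
def denseEvt (n m : ℕ) (κ : ℝ) : Set (BondConfig (Site 3)) :=
  {ω | ∃ x ∈ box 3 n, ∃ x' ∈ box 3 n, ω ∈ pairBad m x x' ∧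
    κ * (box 3 n).card ≤ ((trace n m ω x).card : ℝ) ∧ κ * (box 3 n).card ≤ ((trace n m ω x').card : ℝ)}

/-- Dichotomy: union form ⊆ thin strands ∪ dense bad pair. -/
theorem twoCluster_subset_thin_union_dense (n m : ℕ) (κ : ℝ) :
    twoCluster n m ⊆ thinEvt n m κ ∪ denseEvt n m κ := by
  rintro ω ⟨x, hx, x', hx', hbad⟩
  by_cases h1 : ((trace n m ω x).card : ℝ) < κ * (box 3 n).card
  · exact Or.inl ⟨x, hx, hbad.1.1, h1⟩
  by_cases h2 : ((trace n m ω x').card : ℝ) < κ * (box 3 n).card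
  · exact Or.inl ⟨x', hx', hbad.1.2, h2⟩
  · exact Or.inr ⟨x, hx, x', hx', hbad, not_lt.1 h1, not_lt.1 h2⟩

/-- On the dense event the bad-pair count is at least `(κ|Λ(n)|)²`. -/
theorem sq_le_card_badPairs_of_mem_denseEvt {n m : ℕ} {κ : ℝ} (hκ : 0 < κ) {ω : BondConfig (Site 3)}
    (h : ω ∈ denseEvt n m κ) : (κ * (box 3 n).card) ^ 2 ≤ ((badPairs n m ω).card : ℝ) := by
  obtain ⟨x, -, x', -, hbad, h1, h2⟩ := h
  have h0 : 0 ≤ κ * (box 3 n).card := by positivity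
  calc (κ * (box 3 n).card) ^ 2 = (κ * (box 3 n).card) * (κ * (box 3 n).card) := sq _
    _ ≤ ((trace n m ω x).card : ℝ) * ((trace n m ω x').card : ℝ) :=
        mul_le_mul h1 h2 h0 (h0.trans h1)
    _ ≤ ((badPairs n m ω).card : ℝ) := by
        exact_mod_cast card_trace_mul_le_card_badPairs hbad


/-! ## 3. The lever in full: `PairCountBound` (Markov) and `DensitySampling`, proved -/

theorem measurableSet_reachesOut (m : ℕ) (x : Site 3) : MeasurableSet (reachesOut m x) := by
  have e : reachesOut m x = ⋃ y ∈ innerBoundary (zdGraph 3) (box 3 m), openConnIn ↑(box 3 m) x y := by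
    ext ω
    simp only [reachesOut, Set.mem_setOf_eq, Set.mem_iUnion, exists_prop]
  rw [e]
  exact Finset.measurableSet_biUnion _ fun y _ => DCT16.measurableSet_openConnIn _ x y

theorem measurableSet_pairBad (m : ℕ) (x x' : Site 3) : MeasurableSet (pairBad m x x') :=
  ((measurableSet_reachesOut m x).inter (measurableSet_reachesOut m x')).inter
    (DCT16.measurableSet_openConnIn _ x x').compl

/-- The bad-pair count as a finite sum of indicators. -/
def badCountFn (n m : ℕ) (ω : BondConfig (Site 3)) : ℝ :=
  ∑ q ∈ box 3 n ×ˢ box 3 n, (pairBad m q.1 q.2).indicator (1 : BondConfig (Site 3) → ℝ) ω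

theorem badCountFn_eq_card (n m : ℕ) (ω : BondConfig (Site 3)) :
    badCountFn n m ω = (badPairs n m ω).card := by
  classical
  simp only [badCountFn, badPairs, Finset.card_filter, Set.indicator_apply, Pi.one_apply, Nat.cast_sum,
    Nat.cast_ite, Nat.cast_one, Nat.cast_zero]

theorem badCountFn_nonneg (n m : ℕ) (ω : BondConfig (Site 3)) : 0 ≤ badCountFn n m ω := by
  rw [badCountFn_eq_card]; positivity

theorem integrable_badCountFn (n m : ℕ) : Integrable (badCountFn n m) Pc := by
  unfold badCountFn
  refine integrable_finsetSum _ fun q _ => ?_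
  exact (integrable_const (1 : ℝ)).indicator (measurableSet_pairBad m q.1 q.2)

theorem integral_badCountFn (n m : ℕ) :
    ∫ ω, badCountFn n m ω ∂Pc = ∑ q ∈ box 3 n ×ˢ box 3 n, Pc.real (pairBad m q.1 q.2) := by
  unfold badCountFn
  rw [integral_finsetSum]
  · refine Finset.sum_congr rfl fun q _ => ?_
    exact integral_indicator_one (measurableSet_pairBad m q.1 q.2)
  · intro q _
    exact (integrable_const (1 : ℝ)).indicator (measurableSet_pairBad m q.1 q.2)

/-- **`PairCountBound`** (the card's FIRST LEMMA, Finset form): Markov on the bad-pair count. -/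
theorem pairCountBound (n m : ℕ) {κ : ℝ} (hκ : 0 < κ) :
    Pc.real (denseEvt n m κ) ≤
      ((κ * (box 3 n).card) ^ 2)⁻¹ * ∑ q ∈ box 3 n ×ˢ box 3 n, Pc.real (pairBad m q.1 q.2) := by
  have hc : 0 < ((box 3 n).card : ℝ) := by exact_mod_cast Finset.card_pos.2 ⟨0, zero_mem_box 3 n⟩
  have hK : 0 < (κ * (box 3 n).card) ^ 2 := by positivity
  have hsub : denseEvt n m κ ⊆ {ω | (κ * (box 3 n).card) ^ 2 ≤ badCountFn n m ω} := fun ω hω => by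
    rw [Set.mem_setOf_eq, badCountFn_eq_card]
    exact sq_le_card_badPairs_of_mem_denseEvt hκ hω
  have hmarkov := mul_meas_ge_le_integral_of_nonneg (μ := Pc)
    (Eventually.of_forall (badCountFn_nonneg n m)) (integrable_badCountFn n m) ((κ * (box 3 n).card) ^ 2)
  rw [integral_badCountFn] at hmarkov
  calc Pc.real (denseEvt n m κ) ≤ Pc.real {ω | (κ * (box 3 n).card) ^ 2 ≤ badCountFn n m ω} :=
        measureReal_mono hsub
    _ ≤ ((κ * (box 3 n).card) ^ 2)⁻¹ * ∑ q ∈ box 3 n ×ˢ box 3 n, Pc.real (pairBad m q.1 q.2) := by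
        rw [← div_eq_inv_mul, le_div_iff₀ hK, mul_comm]
        exact hmarkov

/-- The card's `PairCountBound` VERBATIM (its `innerTrace` = `Set.ncard`, its double sum). -/
theorem pairCountBound_card (n m : ℕ) (κ : ℝ) (hκ : 0 < κ) :
    Pc.real {ω | ∃ x ∈ box 3 n, ∃ x' ∈ box 3 n, ω ∈ pairBad m x x' ∧
        κ * (box 3 n).card ≤ (Set.ncard {y : Site 3 | y ∈ box 3 n ∧ ω ∈ openConnIn ↑(box 3 m) x y} : ℝ) ∧
        κ * (box 3 n).card ≤ (Set.ncard {y : Site 3 | y ∈ box 3 n ∧ ω ∈ openConnIn ↑(box 3 m) x' y} : ℝ)}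
      ≤ (κ * (box 3 n).card)⁻¹ ^ 2 * ∑ y ∈ box 3 n, ∑ y' ∈ box 3 n, Pc.real (pairBad m y y') := by
  have e : {ω | ∃ x ∈ box 3 n, ∃ x' ∈ box 3 n, ω ∈ pairBad m x x' ∧
        κ * (box 3 n).card ≤ (Set.ncard {y : Site 3 | y ∈ box 3 n ∧ ω ∈ openConnIn ↑(box 3 m) x y} : ℝ) ∧
        κ * (box 3 n).card ≤ (Set.ncard {y : Site 3 | y ∈ box 3 n ∧ ω ∈ openConnIn ↑(box 3 m) x' y} : ℝ)}
      = denseEvt n m κ := by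
    ext ω
    simp only [Set.mem_setOf_eq, denseEvt, ncard_eq_card_trace]
  rw [e, inv_pow, ← Finset.sum_product (s := box 3 n) (t := box 3 n) (f := fun q => Pc.real (pairBad m q.1 q.2))]
  exact pairCountBound n m hκ

/-- S2 of the card (Finset form of `innerTrace`; equal to the card's by `ncard_eq_card_trace`). -/
def JumpNoThinStrands : Prop :=
  0 < thetaC → ∀ ε : ℝ, 0 < ε → ∃ κ : ℝ, 0 < κ ∧ ∀ᶠ n : ℕ in atTop,
    Pc.real (thinEvt n (outer n) κ) ≤ ε

/-- **`DensitySampling`**, quantitative core: eventually `P(twoCluster) ≤ 2ε`. -/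
theorem eventually_twoCluster_le (h1 : JumpPairDecay) (h2 : JumpNoThinStrands) (hθ : 0 < thetaC)
    {ε : ℝ} (hε : 0 < ε) : ∀ᶠ n : ℕ in atTop, Pc.real (twoCluster n (outer n)) ≤ 2 * ε := by
  obtain ⟨κ, hκ, hthin⟩ := h2 hθ ε hε
  have hε' : 0 < ε * κ ^ 2 := by positivity
  filter_upwards [hthin, h1 hθ _ hε'] with n hn2 hn1
  have hc : 0 < ((box 3 n).card : ℝ) := by exact_mod_cast Finset.card_pos.2 ⟨0, zero_mem_box 3 n⟩
  calc Pc.real (twoCluster n (outer n))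
      ≤ Pc.real (thinEvt n (outer n) κ ∪ denseEvt n (outer n) κ) :=
        measureReal_mono (twoCluster_subset_thin_union_dense _ _ _)
    _ ≤ Pc.real (thinEvt n (outer n) κ) + Pc.real (denseEvt n (outer n) κ) := measureReal_union_le _ _
    _ ≤ ε + ((κ * (box 3 n).card) ^ 2)⁻¹ *
          ∑ q ∈ box 3 n ×ˢ box 3 n, Pc.real (pairBad (outer n) q.1 q.2) :=
        add_le_add hn2 (pairCountBound n (outer n) hκ)
    _ ≤ ε + ((κ * (box 3 n).card) ^ 2)⁻¹ * ∑ q ∈ box 3 n ×ˢ box 3 n, ε * κ ^ 2 := by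
        gcongr with q hq
        rw [Finset.mem_product] at hq
        exact hn1 q.1 hq.1 q.2 hq.2
    _ = 2 * ε := by
        rw [Finset.sum_const, Finset.card_product, nsmul_eq_mul]
        push_cast
        field_simp
        ring

/-- **`DensitySampling`**: S1 ∧ S2 ⇒ the jump half of the crux (union form at `m = ⌈n^{7/6}⌉`). -/
theorem tendsto_twoCluster_of_S1_S2 (h1 : JumpPairDecay) (h2 : JumpNoThinStrands) (hθ : 0 < thetaC) :
    Tendsto (fun n : ℕ => Pc.real (twoCluster n (outer n))) atTop (𝓝 0) := by
  refine Metric.tendsto_atTop.2 fun ε hε => ?_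
  obtain ⟨N, hN⟩ := (eventually_twoCluster_le h1 h2 hθ (half_pos (half_pos hε))).exists_forall_of_atTop
  refine ⟨N, fun n hn => ?_⟩
  rw [Real.dist_eq, sub_zero, abs_of_nonneg measureReal_nonneg]
  have := hN n hn
  linarith

/-- The union-form event is the route's crux event (reshuffling the existentials). -/
theorem twoCluster_eq (n m : ℕ) : twoCluster n m =
    {ω | ∃ x ∈ box 3 n, ∃ x' ∈ box 3 n, ∃ y ∈ innerBoundary (zdGraph 3) (box 3 m),
      ∃ y' ∈ innerBoundary (zdGraph 3) (box 3 m),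
        ω ∈ openConnIn ↑(box 3 m) x y ∧ ω ∈ openConnIn ↑(box 3 m) x' y' ∧
          ω ∉ openConnIn ↑(box 3 m) x x'} := by
  ext ω
  simp only [twoCluster, pairBad, reachesOut, Set.mem_setOf_eq, Set.mem_inter_iff, Set.mem_compl_iff]
  constructor
  · rintro ⟨x, hx, x', hx', ⟨⟨y, hy, hxy⟩, ⟨y', hy', hxy'⟩⟩, hc⟩
    exact ⟨x, hx, x', hx', y, hy, y', hy', hxy, hxy', hc⟩
  · rintro ⟨x, hx, x', hx', y, hy, y', hy', hxy, hxy', hc⟩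
    exact ⟨x, hx, x', hx', ⟨⟨y, hy, hxy⟩, ⟨y', hy', hxy'⟩⟩, hc⟩

/-- **`WorldsSplit`** of the card, PROVED: S1 → S2 → S3 → crux. -/
theorem nearLinearTwoClusterDecay_of_S1_S2_S3 (h1 : JumpPairDecay) (h2 : JumpNoThinStrands)
    (h3 : thetaC = 0 →
      Summit.CriticalPhenomena.PercolationContinuityZ3.Theses.PercShatteringRace.NearLinearTwoClusterDecay) :
    Summit.CriticalPhenomena.PercolationContinuityZ3.Theses.PercShatteringRace.NearLinearTwoClusterDecay := by
  rcases lt_or_eq_of_le (show (0 : ℝ) ≤ thetaC from measureReal_nonneg) with hθ | hθ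
  · have h := tendsto_twoCluster_of_S1_S2 h1 h2 hθ
    simp only [twoCluster_eq] at h
    exact h
  · exact h3 hθ.symm

end TriageR2K1
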